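import Mathlib
import HarnessLib
import Summits.CriticalPhenomena.PercolationContinuityZ3.Theses.PercLayerChain
import Summits.CriticalPhenomena.PercolationContinuityZ3.Theorems.PercLayerChainShadowTransport
import Summits.CriticalPhenomena.PercolationContinuityZ3.Theorems.PercLayerChainMomentGivesReciprocity
import Literature.Probability.Percolation.HalfSpacePinnedPairs

/-!
# Birth skeleton `x1-no-intermittency` for the crux `SectionMomentSubpolynomial`
(stmt-CriticalPhenomena-17581; piece X₁ of the strategist split of `ShadowDensityVanishes`,
route `PercLayerChain`)

Bond percolation on `ℤ³` at `p_c`, `H = {0 ≤ x₀}`, `D_t/W` the section ratio of the wall cluster of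
the origin (`ratio t`), `s_t = P(shadow t)` (`y_t ↔ ∂H in H`), `π_t = P(tall t)` (`C_H(0)` meets
height `t`).  The crux X₁: `∃ q > 1 ∀ b > 0 ∃ C ∀ t ≥ 1, E[(D_t/W)^q] ≤ C t^b`.

THE LINE.  X₁ is interpolated between the first moment `E[D_t/W] = s_t` (shadow transport, PROVED)
and the second moment, and the second moment is controlled by two genuinely different statements:
* STUB 1 `noIntermittency` — the conditional law of the amplification `D_t/W` given tallness is
  MONOFRACTAL up to `t^{o(1)}`: `E[(D_t/W)² ; tall] · π_t ≤ C_b t^b · s_t²`, i.e.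
  `E[(D_t/W)² | tall] ≤ C_b t^b · (E[D_t/W | tall])²` (reverse Hölder / no intermittent tail; reality:
  both sides `~ t^{2(x_s - x_h)} ≈ t`; it says nothing about HOW FAST `s_t` decays);
* STUB 2 `temperedReciprocity` — `∃ a > 0 ∀ b > 0: s_t ≤ C_b t^b π_t^a` (the route's
  `ShadowReciprocity` r3 weakened by `t^{o(1)}`; reality `a ≤ x_h/x_s ≈ 0.49`; jump world: forces
  `π_t ≥ t^{-o(1)}`; on its own + qualitative BGN it bounds nothing).
Composition (kernel-checked, no `sorry` outside the stubs): with `a' = min a (1/2)`, `q = 1 + a'/2`,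
Hölder interpolation `∫ f^q ≤ (∫ f)^{2-q} (∫ f²)^{q-1}` (`ENNReal.lintegral_mul_norm_pow_le`),
`∫ f = s_t` (`shadowTransport_proof`), STUB 1 and STUB 2 give
`(∫ f^q)·π_t^{q-1} ≤ A^{q-1} B^q π_t^{a q} ≤ A^{q-1} B^q π_t^{q-1}` (`a q ≥ q - 1`, `π_t ≤ 1`), and
`π_t^{q-1}` cancels (`π_t = 0` ⟹ `f = 0` a.e. handled apart) — `SectionMomentSubpolynomial_of`
concludes `Summit.CriticalPhenomena.PercolationContinuityZ3.Theses.PercLayerChain.SectionMomentSubpolynomial`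
BY NAME.  Moral: X₁ ⟺ X₁' (= STUB 2, the weaker alternative piece of the split) modulo STUB 1.

DISPROOF USED: none exists yet for this new crux (no `Cruxes/SectionMomentSubpolynomial/Disproof.lean`);
the guards `1 ≤ t`, `0 < b`, `1 < q` are kept; the junk conventions (`ncard = 0` for infinite sets,
`x/0 = 0`) only bite on the BGN-null set where `C_H(0)` is infinite, as for `SectionRatioMoment`.
-/

noncomputable section

namespace Summit.CriticalPhenomena.PercolationContinuityZ3.Cruxes.SectionMomentSubpolynomial.MonofractalAmplification

open MeasureTheory Filter Literature.Probability.Percolation Literature.Probability.LatticeModels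
open Summit.CriticalPhenomena.PercolationContinuityZ3.Theses.PercLayerChain (SectionMomentSubpolynomial)
open scoped ENNReal Topology

/-! ## Objects of the line -/

/-- The critical bond percolation measure on `ℤ³`. -/
abbrev μc : Measure (BondConfig (Site 3)) := bondPercolation (zdGraph 3) (criticalProbI 3)

/-- The half-space `H = {0 ≤ x₀}`. -/
abbrev Hsp : Set (Site 3) := {x | 0 ≤ x 0}

/-- The section ratio `D_t/W` of the wall cluster of the origin (real quotient of `ncard`s, exactly
the integrand of `SectionRatioMoment` / `SectionMomentSubpolynomial`). -/
def ratio (t : ℕ) (ω : BondConfig (Site 3)) : ℝ :=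
  ({v : Site 3 | v 0 = (t : ℤ) ∧ ω ∈ openConnIn Hsp 0 v}.ncard : ℝ) /
    ({v : Site 3 | v 0 = 0 ∧ ω ∈ openConnIn Hsp 0 v}.ncard : ℝ)

/-- The shadow event `{y_t ↔ ∂H in H}` (probability `s_t`). -/
def shadow (t : ℕ) : Set (BondConfig (Site 3)) :=
  {ω | ∃ w : Site 3, w 0 = 0 ∧ ω ∈ openConnIn Hsp (Pi.single 0 (t : ℤ)) w}

/-- The tall event `{C_H(0) meets {x₀ = t}}` (probability `π_t`). -/
def tall (t : ℕ) : Set (BondConfig (Site 3)) :=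
  {ω | ∃ y : Site 3, y 0 = (t : ℤ) ∧ ω ∈ openConnIn Hsp 0 y}

/-- STUB 1 statement (no intermittency of the amplification given tallness):
`E[(D_t/W)²] · π_t ≤ C_b t^b · s_t²` for every `b > 0`. -/
def NoIntermittency : Prop :=
  ∀ b : ℝ, 0 < b → ∃ C : ℝ, ∀ t : ℕ, 1 ≤ t →
    (∫⁻ ω, ENNReal.ofReal (ratio t ω ^ (2 : ℝ)) ∂μc) * μc (tall t) ≤
      ENNReal.ofReal (C * (t : ℝ) ^ b) * μc (shadow t) ^ (2 : ℝ)

/-- STUB 2 statement (tempered reciprocity, the route's `ShadowReciprocity` up to `t^{o(1)}`):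
`∃ a > 0 ∀ b > 0 ∃ C ∀ t ≥ 1, s_t ≤ C t^b π_t^a`. -/
def TemperedReciprocity : Prop :=
  ∃ a : ℝ, 0 < a ∧ ∀ b : ℝ, 0 < b → ∃ C : ℝ, ∀ t : ℕ, 1 ≤ t →
    μc.real (shadow t) ≤ C * (t : ℝ) ^ b * (μc.real (tall t)) ^ a

/-! ## Stubs -/

/-- STUB 1 `noIntermittency`: the conditional second moment of the amplification `D_t/W` given
`{C_H(0) tall}` is at most `t^{o(1)}` times the squared conditional mean (monofractal amplification).
Size: L (a one-scale second-moment computation for the finite critical wall cluster; the natural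
tools are the q-moment transport identity `E[(D_t/W)²] = E[A_t ; y_t ↔ ∂H]` and a footprint–volume
comparison for tall clusters). -/
theorem stub_noIntermittency : NoIntermittency := by
  sorry

/-- STUB 2 `temperedReciprocity`: deep-to-wall is controlled by a power of wall-to-deep up to
`t^{o(1)}`. Size: XL (this is the route's r3 with subpolynomial slack; = the alternative piece X₁'
of the split). -/
theorem stub_temperedReciprocity : TemperedReciprocity := by
  sorry

namespace Registered
/-- registered stub signature -/
abbrev stub_noIntermittency : Prop := NoIntermittency
/-- registered stub signature -/
abbrev stub_temperedReciprocity : Prop := TemperedReciprocity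
end Registered

/-! ## Tools -/

theorem ratio_nonneg (t : ℕ) (ω : BondConfig (Site 3)) : 0 ≤ ratio t ω := by
  unfold ratio; positivity

/-- `ω ↦ ofReal (D_t/W)` is measurable. [folklore] -/
theorem measurable_ofReal_ratio (t : ℕ) :
    Measurable fun ω : BondConfig (Site 3) => ENNReal.ofReal (ratio t ω) :=
  Theorems.MomentGivesReciprocity.measurable_ratio (H := Hsp) (t : ℤ)

/-- Shadow transport in measure form: `∫ ofReal (D_t/W) = P(shadow t)`. [folklore] -/
theorem lintegral_ratio_eq (t : ℕ) :
    ∫⁻ ω, ENNReal.ofReal (ratio t ω) ∂μc = μc (shadow t) := by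
  have hT := Theorems.shadowTransport_proof t
  rw [ofReal_measureReal] at hT
  exact hT

/-- Off the tall event the ratio vanishes: `ofReal (D_t/W) = ofReal (D_t/W) · 𝟙{tall}`. [folklore] -/
theorem ofReal_ratio_eq_mul_indicator (t : ℕ) (ω : BondConfig (Site 3)) :
    ENNReal.ofReal (ratio t ω) = ENNReal.ofReal (ratio t ω) * (tall t).indicator 1 ω :=
  Theorems.MomentGivesReciprocity.ratio_eq_ratio_mul_indicator (H := Hsp) (t : ℤ) ω

/-- **Interpolation** `∫ f^q ≤ (∫ f)^{2-q} (∫ f²)^{q-1}` for `1 ≤ q ≤ 2` (Hölder with the two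
exponents `2 - q`, `q - 1` summing to `1`). [folklore] -/
theorem lintegral_rpow_interpolate {f : BondConfig (Site 3) → ℝ≥0∞} (hf : AEMeasurable f μc)
    {q : ℝ} (hq1 : 1 ≤ q) (hq2 : q ≤ 2) :
    ∫⁻ ω, f ω ^ q ∂μc ≤ (∫⁻ ω, f ω ∂μc) ^ (2 - q) * (∫⁻ ω, f ω ^ (2 : ℝ) ∂μc) ^ (q - 1) := by
  have h := ENNReal.lintegral_mul_norm_pow_le (μ := μc) hf (hf.pow_const (2 : ℝ))
    (p := 2 - q) (q := q - 1) (by linarith) (by linarith) (by ring)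
  refine le_trans (le_of_eq (lintegral_congr fun ω => ?_)) h
  rw [← ENNReal.rpow_mul, ← ENNReal.rpow_add_of_nonneg _ _ (by linarith) (by nlinarith)]
  congr 1; ring

/-! ## Composition -/

/-- **X₁ from the stubs.** `NoIntermittency → TemperedReciprocity → SectionMomentSubpolynomial`,
with `q = 1 + a'/2`, `a' = min a (1/2)`. -/
theorem SectionMomentSubpolynomial_of (h1 : Registered.stub_noIntermittency)
    (h2 : Registered.stub_temperedReciprocity) : SectionMomentSubpolynomial := by
  obtain ⟨a, ha, hrec⟩ := h2
  -- exponents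
  set a' : ℝ := min a (1 / 2) with ha'def
  have ha'0 : 0 < a' := lt_min ha (by norm_num)
  have ha'a : a' ≤ a := min_le_left _ _
  have ha'h : a' ≤ 1 / 2 := min_le_right _ _
  set q : ℝ := 1 + a' / 2 with hqdef
  have hq1 : 1 < q := by rw [hqdef]; linarith
  have hq2 : q ≤ 2 := by rw [hqdef]; linarith
  have hqa : q - 1 ≤ a' * q := by rw [hqdef]; nlinarith
  refine ⟨q, hq1, fun B hB => ?_⟩
  obtain ⟨C₁, hC₁⟩ := h1 (B / 3) (by positivity)
  obtain ⟨C₂, hC₂⟩ := hrec (B / 3) (by positivity)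
  -- the final constant
  refine ⟨max C₁ 1 * (max C₂ 1) ^ (2 : ℕ), fun t ht => ?_⟩
  have ht0 : (0 : ℝ) < t := by exact_mod_cast ht
  have ht1 : (1 : ℝ) ≤ t := by exact_mod_cast ht
  -- names
  set f : BondConfig (Site 3) → ℝ≥0∞ := fun ω => ENNReal.ofReal (ratio t ω) with hfdef
  set S : ℝ≥0∞ := μc (shadow t) with hSdef
  set T : ℝ≥0∞ := μc (tall t) with hTdef
  set A : ℝ≥0∞ := ENNReal.ofReal (max C₁ 1 * (t : ℝ) ^ (B / 3)) with hAdef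
  set Bc : ℝ≥0∞ := ENNReal.ofReal (max C₂ 1 * (t : ℝ) ^ (B / 3)) with hBcdef
  have hfm : AEMeasurable f μc := (measurable_ofReal_ratio t).aemeasurable
  have hT1 : T ≤ 1 := prob_le_one
  have hTtop : T ≠ ⊤ := measure_ne_top _ _
  -- the integrand of the crux is `f^q`
  have hq0 : 0 ≤ q := by linarith
  have hint : ∀ ω, ENNReal.ofReal (ratio t ω ^ q) = f ω ^ q := fun ω =>
    (ENNReal.ofReal_rpow_of_nonneg (p := q) (ratio_nonneg t ω) hq0).symm
  have hgoal_int : ∫⁻ ω, ENNReal.ofReal ((({v : Site 3 | v 0 = (t : ℤ) ∧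
      ω ∈ openConnIn {x : Site 3 | 0 ≤ x 0} 0 v}.ncard : ℝ) /
      ({v : Site 3 | v 0 = 0 ∧ ω ∈ openConnIn {x : Site 3 | 0 ≤ x 0} 0 v}.ncard : ℝ)) ^ q) ∂μc =
      ∫⁻ ω, f ω ^ q ∂μc := lintegral_congr fun ω => hint ω
  -- target bound `A^{q-1} Bc^q ≤ ofReal (K t^B)`
  have hAB : A ^ (q - 1) * Bc ^ q ≤
      ENNReal.ofReal (max C₁ 1 * (max C₂ 1) ^ (2 : ℕ) * (t : ℝ) ^ B) := by
    have hA1 : 1 ≤ max C₁ 1 * (t : ℝ) ^ (B / 3) :=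
      one_le_mul_of_one_le_of_one_le (le_max_right _ _) (Real.one_le_rpow ht1 (by positivity))
    have hB1 : 1 ≤ max C₂ 1 * (t : ℝ) ^ (B / 3) :=
      one_le_mul_of_one_le_of_one_le (le_max_right _ _) (Real.one_le_rpow ht1 (by positivity))
    rw [hAdef, hBcdef, ENNReal.ofReal_rpow_of_nonneg (by positivity) (by linarith),
      ENNReal.ofReal_rpow_of_nonneg (by positivity) (by linarith), ← ENNReal.ofReal_mul (by positivity)]
    refine ENNReal.ofReal_le_ofReal ?_
    -- real inequality: (K₁ t^{B/3})^{q-1} (K₂ t^{B/3})^q ≤ K₁ K₂² t^B, using bases ≥ 1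
    have h1' : (max C₁ 1 * (t : ℝ) ^ (B / 3)) ^ (q - 1) ≤ (max C₁ 1 * (t : ℝ) ^ (B / 3)) ^ (1 : ℝ) :=
      Real.rpow_le_rpow_of_exponent_le hA1 (by linarith)
    have h2' : (max C₂ 1 * (t : ℝ) ^ (B / 3)) ^ q ≤ (max C₂ 1 * (t : ℝ) ^ (B / 3)) ^ (2 : ℝ) :=
      Real.rpow_le_rpow_of_exponent_le hB1 hq2
    rw [Real.rpow_one] at h1'
    rw [Real.rpow_two] at h2'
    have h3 : (max C₁ 1 * (t : ℝ) ^ (B / 3)) * (max C₂ 1 * (t : ℝ) ^ (B / 3)) ^ 2 =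
        max C₁ 1 * (max C₂ 1) ^ (2 : ℕ) * ((t : ℝ) ^ (B / 3)) ^ (3 : ℕ) := by ring
    have h4 : ((t : ℝ) ^ (B / 3)) ^ (3 : ℕ) = (t : ℝ) ^ B := by
      rw [← Real.rpow_natCast, ← Real.rpow_mul ht0.le]; norm_num
    calc (max C₁ 1 * (t : ℝ) ^ (B / 3)) ^ (q - 1) * (max C₂ 1 * (t : ℝ) ^ (B / 3)) ^ q
        ≤ (max C₁ 1 * (t : ℝ) ^ (B / 3)) * (max C₂ 1 * (t : ℝ) ^ (B / 3)) ^ 2 :=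
          mul_le_mul h1' h2' (by positivity) (by positivity)
      _ = max C₁ 1 * (max C₂ 1) ^ (2 : ℕ) * (t : ℝ) ^ B := by rw [h3, h4]
  rw [hgoal_int]
  refine le_trans ?_ hAB
  -- STUB 1 and STUB 2 with the enlarged constants
  have hS1 : (∫⁻ ω, f ω ^ (2 : ℝ) ∂μc) * T ≤ A * S ^ (2 : ℝ) := by
    have h := hC₁ t ht
    have hf2 : ∀ ω, ENNReal.ofReal (ratio t ω ^ (2 : ℝ)) = f ω ^ (2 : ℝ) := fun ω =>
      (ENNReal.ofReal_rpow_of_nonneg (p := (2 : ℝ)) (ratio_nonneg t ω) (by norm_num)).symm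
    rw [lintegral_congr hf2] at h
    refine h.trans (mul_le_mul_right' (ENNReal.ofReal_le_ofReal
      (mul_le_mul_of_nonneg_right (le_max_left _ _) (by positivity))) _)
  have hS2 : S ≤ Bc * T ^ a' := by
    have h := hC₂ t ht
    have hTa : (μc.real (tall t)) ^ a ≤ (μc.real (tall t)) ^ a' :=
      Real.rpow_le_rpow_of_exponent_ge' measureReal_nonneg measureReal_le_one ha'0.le ha'a
    have h' : μc.real (shadow t) ≤ max C₂ 1 * (t : ℝ) ^ (B / 3) * (μc.real (tall t)) ^ a' :=
      h.trans (mul_le_mul (mul_le_mul_of_nonneg_right (le_max_left _ _) (by positivity)) hTa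
        (by positivity) (by positivity))
    have h'' := ENNReal.ofReal_le_ofReal h'
    rw [ENNReal.ofReal_mul (by positivity),
      ← ENNReal.ofReal_rpow_of_nonneg measureReal_nonneg ha'0.le, ofReal_measureReal,
      ofReal_measureReal] at h''
    exact h''
  -- case `T = 0`: then `f^q` vanishes off a null set and the moment is `0`
  by_cases hT0 : T = 0
  · have hind : ∀ ω, f ω ^ q = (tall t).indicator (fun ω => f ω ^ q) ω := by
      intro ω
      by_cases hω : ω ∈ tall t
      · rw [Set.indicator_of_mem hω]
      · have hf0 : f ω = 0 := by
          have h := ofReal_ratio_eq_mul_indicator t ω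
          rw [Set.indicator_of_notMem hω, mul_zero] at h
          exact h
        rw [Set.indicator_of_notMem hω, hf0, ENNReal.zero_rpow_of_pos (lt_trans zero_lt_one hq1)]
    have hmeas : MeasurableSet (tall t) :=
      Theorems.MomentGivesReciprocity.measurableSet_reach (H := Hsp) (t : ℤ)
    have hzero : ∫⁻ ω, f ω ^ q ∂μc = 0 := by
      rw [lintegral_congr hind, lintegral_indicator hmeas]
      exact setLIntegral_measure_zero _ _ hT0
    rw [hzero]
    exact zero_le
  -- main case `T ≠ 0`: interpolate, insert the stubs, cancel `T^{q-1}`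
  · have hstep1 : ∫⁻ ω, f ω ^ q ∂μc ≤ S ^ (2 - q) * (∫⁻ ω, f ω ^ (2 : ℝ) ∂μc) ^ (q - 1) := by
      have h := lintegral_rpow_interpolate hfm hq1.le hq2
      rwa [lintegral_ratio_eq t] at h
    have hkey : (∫⁻ ω, f ω ^ q ∂μc) * T ^ (q - 1) ≤ A ^ (q - 1) * Bc ^ q * T ^ (q - 1) :=
      calc (∫⁻ ω, f ω ^ q ∂μc) * T ^ (q - 1)
          ≤ S ^ (2 - q) * (∫⁻ ω, f ω ^ (2 : ℝ) ∂μc) ^ (q - 1) * T ^ (q - 1) :=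
            mul_le_mul_right' hstep1 _
        _ = S ^ (2 - q) * ((∫⁻ ω, f ω ^ (2 : ℝ) ∂μc) * T) ^ (q - 1) := by
            rw [mul_assoc, ← ENNReal.mul_rpow_of_nonneg _ _ (by linarith)]
        _ ≤ S ^ (2 - q) * (A * S ^ (2 : ℝ)) ^ (q - 1) :=
            mul_le_mul_left' (ENNReal.rpow_le_rpow hS1 (by linarith)) _
        _ = A ^ (q - 1) * S ^ q := by
            rw [ENNReal.mul_rpow_of_nonneg _ _ (by linarith), ← ENNReal.rpow_mul, mul_left_comm,
              ← ENNReal.rpow_add_of_nonneg _ _ (by linarith) (by nlinarith)]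
            congr 2
            ring
        _ ≤ A ^ (q - 1) * (Bc * T ^ a') ^ q :=
            mul_le_mul_left' (ENNReal.rpow_le_rpow hS2 (by linarith)) _
        _ = A ^ (q - 1) * Bc ^ q * T ^ (a' * q) := by
            rw [ENNReal.mul_rpow_of_nonneg _ _ (by linarith), ← ENNReal.rpow_mul, mul_assoc]
        _ ≤ A ^ (q - 1) * Bc ^ q * T ^ (q - 1) :=
            mul_le_mul_left' (ENNReal.rpow_le_rpow_of_exponent_ge hT1 hqa) _
    have hc0 : T ^ (q - 1) ≠ 0 := (ENNReal.rpow_pos (pos_iff_ne_zero.2 hT0) hTtop).ne'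
    have hctop : T ^ (q - 1) ≠ ⊤ := ENNReal.rpow_ne_top_of_nonneg (by linarith) hTtop
    exact (ENNReal.mul_le_mul_iff_left hc0 hctop).1 hkey

end Summit.CriticalPhenomena.PercolationContinuityZ3.Cruxes.SectionMomentSubpolynomial.MonofractalAmplification

end
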